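import Summits.HodgeConjecture.HodgeConjecture.Theorems.SecondaryPeriodsRiemannWeightOneStubAlgebraisationSmoothAffineChart
import Literature.NumberTheory.Transcendental.AnalytificationChartsProofs
import Literature.Geometry.GeometricMeasureTheory.HausdorffLipschitzCover
import Mathlib.Topology.MetricSpace.HausdorffDimension
import HarnessLib

/-!
# Crux `RiemannWeightOne` (stmt-HodgeConjecture-16406), stub `stub_algebraisationSmooth`, part (G5): the relative dimension is at most `n`

Helper file for the registered stub `stub_algebraisationSmooth` (Serre, GAGA §2 n°6). If the
`ℂ`-scheme `X`, locally of finite type and smooth of relative dimension `e`, is analytified by a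
complex `n`-manifold `M` (`φ : M ≃ₜ X(ℂ)` pulling regular functions back to holomorphic ones),
then `e ≤ n`:

* `Dimension.relativeDimension_le` — an algebraic chart `c : X(ℂ) ⊇ V → ℂᵉ` at `φ m₀` (the tree's
  `exists_algebraicChart_holds`) has regular coordinate functions, so `c ∘ φ ∘ chart⁻¹` is a `C¹`
  map from an open ball of `ℂⁿ` ONTO an open subset of `ℂᵉ`; Hausdorff dimension does not
  increase under `C¹` maps (Mathlib `ContDiffOn.dimH_image_le`) and open sets have full dimension
  (`Real.dimH_of_mem_nhds`), so `2e ≤ 2n`.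

Also a small fact for the degenerate case `N = 0` of the stub: an immersion into a
`0`-dimensional space has `0`-dimensional source (`Dimension.eq_zero_of_injective_linearMap`).

## References

* [SerreGAGA1956] J.-P. Serre, GAGA, Ann. Inst. Fourier 6 (1956), §2 n°6 Prop. 3 and Cor. 2.
-/

noncomputable section

set_option linter.dupNamespace false

namespace Summit.HodgeConjecture.HodgeConjecture.Theorems.RiemannWeightOne

namespace Dimension

open scoped Manifold ContDiff Topology ENNReal
open CategoryTheory AlgebraicGeometry Filter Set Function
open Literature.AlgebraicGeometry.Motives Literature.AlgebraicGeometry.Motives.AlgPoints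
open Literature.NumberTheory.Transcendental (IsAnalytification)
open Literature.AlgebraicGeometry.HodgeTheory
open AffineChart

/-- **The relative dimension of an analytified smooth scheme is at most the dimension of the
manifold.** [cite: SerreGAGA1956, §2 n°6 Prop. 3 and Cor. 2] -/
theorem relativeDimension_le {n e : ℕ} {M : Type} [TopologicalSpace M] [ChartedSpace (Fin n → ℂ) M]
    [IsManifold 𝓘(ℂ, Fin n → ℂ) ω M] {X : SchemeOver ℂ} [LocallyOfFiniteType X.hom] [SmoothOfRelativeDimension e X.hom]
    {φ : M → ComplexPoints X} (hφ : IsAnalytification (Fin n → ℂ) X n φ) (m₀ : M) : e ≤ n := by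
  obtain ⟨c, hP₀c, ⟨U₁, x, hsrc, hcoord⟩, -⟩ :=
    Literature.NumberTheory.Transcendental.exists_algebraicChart_holds X e (φ m₀)
  set ec := chartOfAnalytification hφ m₀ with hec
  have hm₀src : φ m₀ ∈ ec.source := mem_chartOfAnalytification_source hφ m₀
  set z₀ := ec (φ m₀) with hz₀
  -- the open set where the chart expression of `c` is defined
  set T : Set (Fin n → ℂ) := ec.target ∩ ec.symm ⁻¹' c.source with hT
  have hTo : IsOpen T := ec.isOpen_inter_preimage_symm c.open_source
  have hz₀T : z₀ ∈ T := ⟨ec.map_source hm₀src, by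
    show ec.symm z₀ ∈ c.source
    rw [hz₀, ec.left_inv hm₀src]
    exact hP₀c⟩
  set g : (Fin n → ℂ) → (Fin e → ℂ) := c ∘ ec.symm with hg
  -- `g` is `C¹` on `T` (its coordinates are regular functions along the analytification)
  have hgC : ContDiffOn ℂ ω g T := by
    rw [hg, contDiffOn_pi]
    intro i
    have hsub : T ⊆ ec.target ∩ ec.symm ⁻¹' {Q | Q.pt ∈ (↑U₁ : X.left.Opens)} :=
      fun z hz => ⟨hz.1, hsrc hz.2⟩
    refine ((contDiffOn_chartOfAnalytification hφ m₀ U₁ (x i)).mono hsub).congr fun z hz => ?_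
    exact hcoord _ hz.2 i
  have hgR : ContDiffOn ℝ 1 g T := (hgC.restrict_scalars ℝ).of_le (by norm_cast)
  -- a ball inside `T`
  obtain ⟨r, hr, hball⟩ := Metric.isOpen_iff.1 hTo z₀ hz₀T
  have hdim_le : dimH (g '' Metric.ball z₀ r) ≤ (2 * n : ℕ) := by
    calc dimH (g '' Metric.ball z₀ r) ≤ dimH (Metric.ball z₀ r) :=
          (hgR.mono hball).dimH_image_le (convex_ball z₀ r) Subset.rfl
      _ ≤ dimH (Set.univ : Set (Fin n → ℂ)) := dimH_mono (Set.subset_univ _)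
      _ = (2 * n : ℕ) := by rw [Real.dimH_univ_eq_finrank, Literature.Geometry.GeometricMeasureTheory.finrank_real_pi_complex]
  -- the image is open and non-empty, hence of full dimension `2e`
  have hopen : IsOpen (g '' Metric.ball z₀ r) := by
    rw [hg, Set.image_comp]
    refine c.isOpen_image_of_subset_source ?_ fun P ⟨z, hz, hzP⟩ => hzP ▸ (hball hz).2
    exact ec.symm.isOpen_image_of_subset_source Metric.isOpen_ball fun z hz => (hball hz).1
  have hmem : g '' Metric.ball z₀ r ∈ 𝓝 (g z₀) :=
    hopen.mem_nhds ⟨z₀, Metric.mem_ball_self hr, rfl⟩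
  have hdim_eq : dimH (g '' Metric.ball z₀ r) = (2 * e : ℕ) := by
    rw [Real.dimH_of_mem_nhds hmem, Literature.Geometry.GeometricMeasureTheory.finrank_real_pi_complex]
  rw [hdim_eq] at hdim_le
  have h : 2 * e ≤ 2 * n := by exact_mod_cast hdim_le
  omega

/-- A `ℂ`-linear injection `ℂⁿ → ℂ⁰` forces `n = 0`. [folklore] -/
theorem eq_zero_of_injective_linearMap {n : ℕ} (f : (Fin n → ℂ) →ₗ[ℂ] (Fin 0 → ℂ))
    (hf : Injective f) : n = 0 := by
  by_contra hn
  have hlt : 0 < n := Nat.pos_of_ne_zero hn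
  have h1 : (Pi.single (⟨0, hlt⟩ : Fin n) (1 : ℂ) : Fin n → ℂ) ≠ 0 := by
    intro h
    have := congrFun h ⟨0, hlt⟩
    simp at this
  exact h1 (hf (Subsingleton.elim _ _))

end Dimension

open scoped Manifold ContDiff in
open AlgebraicGeometry Literature.AlgebraicGeometry.Motives Literature.NumberTheory.Transcendental in
/-- **Registered sub-goal `stub_algebraisationSmooth_dimension`** of the stub
`stub_algebraisationSmooth` (part (G5), `Dimension.relativeDimension_le`).
[cite: SerreGAGA1956, §2 n°6 Prop. 3 and Cor. 2] -/
theorem stub_algebraisationSmooth_dimension :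
    ∀ ⦃n e : ℕ⦄ ⦃M : Type⦄ [TopologicalSpace M] [ChartedSpace (Fin n → ℂ) M]
      [IsManifold 𝓘(ℂ, Fin n → ℂ) ω M] ⦃X : SchemeOver ℂ⦄ [LocallyOfFiniteType X.hom]
      [SmoothOfRelativeDimension e X.hom] ⦃φ : M → ComplexPoints X⦄,
      IsAnalytification (Fin n → ℂ) X n φ → M → e ≤ n :=
  fun _ _ _ _ _ _ _ _ _ _ hφ m₀ => Dimension.relativeDimension_le hφ m₀

end Summit.HodgeConjecture.HodgeConjecture.Theorems.RiemannWeightOne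

end
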